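import Literature.Topology.FourManifolds.WildCollarFlapInjective
import Literature.Topology.FourManifolds.KirbyMovesStrictHandleSlide
import Literature.Topology.FourManifolds.TubularNbhdSqueeze
import Literature.Topology.FourManifolds.LinkingNumberPushOffInstance
import Literature.Topology.FourManifolds.PreBandData
import HarnessLib

/-!
# A wild band between two strands of a tubular neighbourhood

Topic `Literature/Topology/FourManifolds`. Given any oriented tubular neighbourhood `μ` of a knot
`K`, this file builds, entirely in the coordinates of `μ`, the configuration refuting the
mis-stated slide lemma `FramedLink.IsStrictHandleSlide.slideDiffeoAligned`
(`KirbyMovesSlideAlignRefutation.lean`):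

* the **slide tube** `slideTube μ = μ.squeeze 1` of `K` (image `μ (S¹ × D̊²)`), its push-off
  `P μ = (slideTube μ).pushOff`, the strand `x ↦ μ (x, q)`, `q = (1/√5, 0)`, and its collar
  `(slideTube μ).collar ⊆ μ (S¹ × [0, 1/√5) e₀)`;
* the **attaching knot** `KI μ`, the *reversed* strand `x ↦ μ (x̄, p)`, `p = (1 + 1/√5, 0)`
  (outside the slide tube);
* the **wild band** `band μ : ℝ² → S³`, `x ↦ μ (circlePoint X, w)` with
  `(X, w) = Ψ x`: for `x₀ ≥ 1/8` the honest product band `(-x₁, γ x₀)` along the planar arc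
  `γ x₀ = q + (1 - x₀)(cos α x₀, sin α x₀)` from `p` to `q` (polar about `q`, radius strictly
  decreasing, arriving at `q` vertically so as to miss the collar), and for `x₀ < 1/8` the wild
  collar flap `(axial, p + fibre)` of `WildCollarFlap.lean` in the variables
  `(s, y) = (-3/100 - x₀, -x₁)` — the two agree on `-7/200 < x₀ < 1/4`;
* `WildStrand.preBandData μ : PreBandData (KI μ) (P μ) (range K ∪ (slideTube μ).collar)` — the
  wild band is honest **pre-band data** in the sense of the tree (`PreBandData.lean`: a `C^∞` map
  which is an injective immersion of the open collar square `squareNhd (1/10)`, meeting `KI μ`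
  exactly in the left edge line upwards and `P μ` exactly in the right edge line downwards, off
  `K` and off the collar);
* `WildStrand.mem_support` — **its support contains the punctured meridian disc**
  `{μ (circlePoint (3/5), p + w) | 0 < ‖w‖ < 1/50}` of the attaching knot.

Everything is a definition or proved; no named facts. The honest part is the printed band of a
handle slide (R. C. Kirby, *The Topology of 4-Manifolds* (1989), Ch. I §4, Fig. 4.2: the band
reaches the push-off `Kⱼ'` from outside the collar between `Kⱼ` and `Kⱼ'`); the wild flap is
what the tree's `BandData` (an injective immersion of the *open* square) additionally allows.

## References

* R. C. Kirby, *The Topology of 4-Manifolds*, LNM 1374, Springer (1989), Ch. I §4.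
  [cite: Kirby1989, Ch. I §4]
* R. E. Gompf, A. I. Stipsicz, *4-Manifolds and Kirby Calculus* (1999), §5.1 (band sums).
  [cite: GompfStipsicz1999, §5.1]
-/

noncomputable section

open Set Real Filter Function
open scoped Manifold ContDiff Topology

namespace Literature.Topology.FourManifolds

/-- Local notation: `𝔼 n` is the model Euclidean space `EuclideanSpace ℝ (Fin n)`. -/
local notation "𝔼 " n:arg => EuclideanSpace ℝ (Fin n)

/-- Local notation: `𝕊 n` is the unit sphere in `EuclideanSpace ℝ (Fin (n + 1))`. -/
local notation "𝕊 " n:arg => (Metric.sphere (0 : EuclideanSpace ℝ (Fin (n + 1))) 1)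

namespace WildStrand

open WildFlap

attribute [local instance] fact_finrank_euclideanSpace_two fact_finrank_euclideanSpace_four

/-- Shorthand for Mathlib's smooth transition `χ`. [folklore] -/
local notation "χ" => Real.smoothTransition

/-! ## Planar constants -/

/-- The abscissa `1/√5` of the push-off strand. [folklore] -/
def qc : ℝ := 1 / Real.sqrt 5

/-- `qc_pos`: an elementary bound or non-vanishing for the explicit construction (see the module docstring). [folklore] -/
theorem qc_pos : 0 < qc := by unfold qc; positivity

/-- `qc_sq`: an elementary property of the explicit construction (see the module docstring). [folklore] -/
theorem qc_sq : qc ^ 2 = 1 / 5 := by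
  unfold qc
  rw [div_pow, one_pow, Real.sq_sqrt (by norm_num)]

/-- `qc_lt_half`: an elementary bound or non-vanishing for the explicit construction (see the module docstring). [folklore] -/
theorem qc_lt_half : qc < 1 / 2 := by
  have h := qc_sq
  have h0 := qc_pos
  nlinarith

/-- The push-off strand sits at `q = (1/√5, 0)`. [folklore] -/
def q : 𝔼 2 := qc • e₀

/-- The attaching strand sits at `p = (1 + 1/√5, 0)`. [folklore] -/
def pI : 𝔼 2 := (1 + qc) • e₀

/-- `e₀_apply_zero`: a value / unfolding of the explicit construction (see the module docstring). [folklore] -/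
@[simp] theorem e₀_apply_zero : e₀ 0 = 1 := by simp [e₀]
/-- Second coordinate of `e₀`. [folklore] -/
@[simp] theorem e₀_apply_one : e₀ 1 = 0 := by simp [e₀]
/-- `q_apply_zero`: a value / unfolding of the explicit construction (see the module docstring). [folklore] -/
@[simp] theorem q_apply_zero : q 0 = qc := by simp [q]
/-- Second coordinate of `q`. [folklore] -/
@[simp] theorem q_apply_one : q 1 = 0 := by simp [q]
/-- `pI_apply_zero`: a value / unfolding of the explicit construction (see the module docstring). [folklore] -/
@[simp] theorem pI_apply_zero : pI 0 = 1 + qc := by simp [pI]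
/-- Second coordinate of `p`. [folklore] -/
@[simp] theorem pI_apply_one : pI 1 = 0 := by simp [pI]

/-- `pI_eq`: a value / unfolding of the explicit construction (see the module docstring). [folklore] -/
theorem pI_eq : pI = q + e₀ := by simp only [pI, q, add_smul, one_smul, add_comm]

/-- `norm_e₀`: an elementary bound or non-vanishing for the explicit construction (see the module docstring). [folklore] -/
theorem norm_e₀ : ‖e₀‖ = 1 := by simp [e₀]

/-- `norm_pI`: an elementary bound or non-vanishing for the explicit construction (see the module docstring). [folklore] -/
theorem norm_pI : ‖pI‖ = 1 + qc := by
  rw [pI, norm_smul, norm_e₀, mul_one, Real.norm_of_nonneg (by linarith [qc_pos])]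

/-- `pI_ne_zero`: an elementary bound or non-vanishing for the explicit construction (see the module docstring). [folklore] -/
theorem pI_ne_zero : pI ≠ 0 := by
  rw [← norm_ne_zero_iff, norm_pI]; linarith [qc_pos]

/-- `q_ne_zero`: an elementary bound or non-vanishing for the explicit construction (see the module docstring). [folklore] -/
theorem q_ne_zero : q ≠ 0 := by
  intro h; have := congrArg (fun v : 𝔼 2 ↦ v 0) h; simp at this; exact qc_pos.ne' this

/-- `pI_ne_q`: an elementary bound or non-vanishing for the explicit construction (see the module docstring). [folklore] -/
theorem pI_ne_q : pI ≠ q := by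
  intro h; have := congrArg (fun v : 𝔼 2 ↦ v 0) h; simp at this

/-- The point `(1, 0)` of the circle has coordinate vector `e₀`. [folklore] -/
theorem coe_circlePoint_zero : ((circlePoint 0 : 𝕊 1) : 𝔼 2) = e₀ := by
  ext i; fin_cases i <;> simp [e₀, circlePoint_apply_zero, circlePoint_apply_one]

/-- The framing base vector is `½ e₀`. [folklore] -/
theorem framingBaseVector_eq : framingBaseVector = (1 / 2 : ℝ) • e₀ := by
  rw [framingBaseVector, coe_circlePoint_zero]

/-- A coordinate is bounded by the norm. [folklore] -/
theorem abs_apply_le_norm (w : 𝔼 2) (i : Fin 2) : |w i| ≤ ‖w‖ := by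
  rw [EuclideanSpace.norm_eq]
  refine Real.abs_le_sqrt ?_
  rw [Fin.sum_univ_two]
  fin_cases i <;> simp <;> nlinarith [sq_nonneg (w 0), sq_nonneg (w 1)]

/-! ## The two tubes and the two strands -/

variable {K : Knot} (μ : Knot.TubularNbhd K)

/-- **The slide tube**: `μ` squeezed to its open unit tube. [folklore] -/
def slideTube : Knot.TubularNbhd K := μ.squeeze (r := 1) one_pos

/-- The squeeze moves the framing base vector to `q`. [folklore] -/
theorem squeeze_framingBaseVector : Literature.Topology.FourManifolds.squeeze 1 framingBaseVector = q := by
  rw [squeeze_def, squeezeFactor_def, norm_framingBaseVector, framingBaseVector_eq, smul_smul, q]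
  congr 1
  rw [qc, one_mul]
  have h5 : Real.sqrt (1 + (1 / 2 : ℝ) ^ 2) = Real.sqrt 5 / 2 := by
    rw [show (1 : ℝ) + (1 / 2) ^ 2 = 5 / 4 by norm_num, Real.sqrt_div' _ (by norm_num : (0:ℝ) ≤ 4),
      show Real.sqrt 4 = 2 by rw [show (4:ℝ) = 2 ^ 2 by norm_num, Real.sqrt_sq (by norm_num)]]
  rw [h5]
  have : Real.sqrt 5 ≠ 0 := by positivity
  field_simp

/-- The squeeze moves `t • e₀'` (`e₀' = ½ e₀`, `0 ≤ t`) to `c • e₀` with `0 ≤ c`, and `c < 1/√5`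
when `t < 1`. [folklore] -/
theorem squeeze_smul_framingBaseVector {t : ℝ} (ht : t ∈ Ico (0 : ℝ) 1) :
    ∃ c : ℝ, 0 ≤ c ∧ c < qc ∧
      Literature.Topology.FourManifolds.squeeze 1 (t • framingBaseVector) = c • e₀ := by
  refine ⟨squeezeFactor (t • framingBaseVector) * (t / 2), ?_, ?_, ?_⟩
  · exact mul_nonneg (squeezeFactor_pos _).le (by linarith [ht.1])
  · -- `c² = (t/2)² / (1 + (t/2)²) < 1/5` as `t < 1`
    have hn : ‖t • framingBaseVector‖ = t / 2 := by
      rw [norm_smul, norm_framingBaseVector, Real.norm_of_nonneg ht.1]; ring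
    have hsq := squeezeFactor_sq_mul (t • framingBaseVector)
    rw [hn] at hsq
    have hf := squeezeFactor_pos (t • framingBaseVector)
    set f := squeezeFactor (t • framingBaseVector)
    have hc2 : (f * (t / 2)) ^ 2 < qc ^ 2 := by
      rw [qc_sq]
      have ht2 : t ^ 2 < 1 := by nlinarith [ht.1, ht.2]
      nlinarith
    exact lt_of_pow_lt_pow_left₀ 2 qc_pos.le hc2
  · rw [squeeze_def, one_mul, framingBaseVector_eq, smul_smul, smul_smul]
    congr 1; ring

/-- The slide tube on points. [folklore] -/
theorem slideTube_apply (x : 𝕊 1) (w : 𝔼 2) :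
    slideTube μ (x, w) = μ (x, Literature.Topology.FourManifolds.squeeze 1 w) := rfl

/-- **The image of the slide tube is the open unit tube of `μ`.** [folklore] -/
theorem range_slideTube : range ⇑(slideTube μ) = ⇑μ '' (univ ×ˢ Metric.ball (0 : 𝔼 2) 1) :=
  μ.range_squeeze one_pos

/-- **The push-off strand** `P μ`, the push-off of the slide tube. [folklore] -/
def P : Knot := (slideTube μ).pushOff

/-- The push-off strand on points: `P μ x = μ (x, q)`. [folklore] -/
theorem P_apply (x : 𝕊 1) : P μ x = μ (x, q) := by
  rw [P, Knot.TubularNbhd.pushOff_apply, slideTube_apply, squeeze_framingBaseVector]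

/-- `range_P`: an elementary property of the explicit construction (see the module docstring). [folklore] -/
theorem range_P : range ⇑(P μ) = ⇑μ '' (univ ×ˢ {q}) := by
  ext z; simp only [mem_range, P_apply, mem_image, mem_prod, mem_univ, true_and, mem_singleton_iff]
  constructor
  · rintro ⟨x, rfl⟩; exact ⟨(x, q), rfl, rfl⟩
  · rintro ⟨⟨x, w⟩, rfl, rfl⟩; exact ⟨x, rfl⟩

/-- **The collar of the slide tube lies on the segment `[0, 1/√5) e₀`** in every fibre.
[folklore] -/
theorem mem_collar_slideTube {z : 𝕊 3} (hz : z ∈ (slideTube μ).collar) :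
    ∃ (x : 𝕊 1) (c : ℝ), 0 ≤ c ∧ c < qc ∧ z = μ (x, c • e₀) := by
  obtain ⟨x, t, ht, rfl⟩ := hz
  obtain ⟨c, hc0, hc1, hc⟩ := squeeze_smul_framingBaseVector ht
  exact ⟨x, c, hc0, hc1, by rw [slideTube_apply, hc]⟩

/-- `two_mul_one_add_qc_pos`: an elementary bound or non-vanishing for the explicit construction (see the module docstring). [folklore] -/
theorem two_mul_one_add_qc_pos : 0 < 2 * (1 + qc) := by linarith [qc_pos]

/-- The tube whose push-off is the attaching strand: `μ` rescaled by `2 (1 + 1/√5)`. [folklore] -/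
def strandTube : Knot.TubularNbhd K := μ.scale (2 * (1 + qc)) two_mul_one_add_qc_pos

/-- `strandTube_pushOff_apply`: a value / unfolding of the explicit construction (see the module docstring). [folklore] -/
theorem strandTube_pushOff_apply (x : 𝕊 1) : (strandTube μ).pushOff x = μ (x, pI) := by
  rw [Knot.TubularNbhd.pushOff_apply, strandTube, Knot.TubularNbhd.scale_apply,
    framingBaseVector_eq, smul_smul, pI]
  congr 2; ring

/-- **The attaching knot** `KI μ`: the reversed strand through `p`. [folklore] -/
def KI : Knot := (strandTube μ).pushOff.reverse

/-- Reflection of the circle in angle form. [folklore] -/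
theorem reflectLast_one_circlePoint' (θ : ℝ) : reflectLast 1 (circlePoint θ) = circlePoint (-θ) := by
  ext i
  fin_cases i
  · simp [reflectLast, circlePoint_apply_zero, Real.cos_neg]
  · simp [reflectLast, circlePoint_apply_one, Real.sin_neg]

/-- The attaching knot on points. [folklore] -/
theorem KI_apply (x : 𝕊 1) : KI μ x = μ (reflectLast 1 x, pI) := by
  rw [KI, SphereEmbedding.coe_reverse, comp_apply, strandTube_pushOff_apply]

/-- The attaching knot in angle form: `KI μ (circlePoint θ) = μ (circlePoint (-θ), p)`. [folklore] -/
theorem KI_apply_circlePoint (θ : ℝ) : KI μ (circlePoint θ) = μ (circlePoint (-θ), pI) := by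
  rw [KI_apply, reflectLast_one_circlePoint']

/-- `reflectLast_one_surjective`: an elementary property of the explicit construction (see the module docstring). [folklore] -/
theorem reflectLast_one_surjective : Surjective (reflectLast 1) := fun x ↦
  ⟨reflectLast 1 x, by
    obtain ⟨θ, rfl⟩ := circlePoint_surjective x
    rw [reflectLast_one_circlePoint', reflectLast_one_circlePoint', neg_neg]⟩

/-- `range_KI`: an elementary property of the explicit construction (see the module docstring). [folklore] -/
theorem range_KI : range ⇑(KI μ) = ⇑μ '' (univ ×ˢ {pI}) := by
  ext z; simp only [mem_range, KI_apply, mem_image, mem_prod, mem_univ, true_and, mem_singleton_iff]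
  constructor
  · rintro ⟨x, rfl⟩; exact ⟨(reflectLast 1 x, pI), rfl, rfl⟩
  · rintro ⟨⟨x, w⟩, rfl, rfl⟩
    obtain ⟨x', rfl⟩ := reflectLast_one_surjective x
    exact ⟨x', rfl⟩

/-- Membership in the image of a fibre point: `z ∈ μ (S¹ × {w})` iff `z = μ (x, w)`. [folklore] -/
theorem mem_image_singleton_iff {w : 𝔼 2} {z : 𝕊 3} :
    z ∈ ⇑μ '' (univ ×ˢ {w}) ↔ ∃ x : 𝕊 1, z = μ (x, w) := by
  simp only [mem_image, mem_prod, mem_univ, true_and, mem_singleton_iff]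
  constructor
  · rintro ⟨⟨x, w'⟩, rfl, rfl⟩; exact ⟨x, rfl⟩
  · rintro ⟨x, rfl⟩; exact ⟨(x, w), rfl, rfl⟩

/-- `μ (x, w) ∈ μ (S¹ × {w'})` iff `w = w'`. [folklore] -/
theorem apply_mem_image_singleton_iff {x : 𝕊 1} {w w' : 𝔼 2} :
    μ (x, w) ∈ ⇑μ '' (univ ×ˢ {w'}) ↔ w = w' := by
  rw [mem_image_singleton_iff]
  constructor
  · rintro ⟨x', h⟩; exact congrArg Prod.snd (μ.injective h)
  · rintro rfl; exact ⟨x, rfl⟩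

/-! ## The planar arc `γ` -/

/-- The turning angle of the arc: `0` for `x₀ ≤ 1/4`, `π/2` for `x₀ ≥ 3/4`. [folklore] -/
def αc (x₀ : ℝ) : ℝ := π / 2 * χ (2 * x₀ - 1 / 2)

/-- `αc_of_le`: a value / unfolding of the explicit construction (see the module docstring). [folklore] -/
theorem αc_of_le {x₀ : ℝ} (h : x₀ ≤ 1 / 4) : αc x₀ = 0 := by
  rw [αc, Real.smoothTransition.zero_of_nonpos (by linarith), mul_zero]

/-- `αc_of_ge`: a value / unfolding of the explicit construction (see the module docstring). [folklore] -/
theorem αc_of_ge {x₀ : ℝ} (h : 3 / 4 ≤ x₀) : αc x₀ = π / 2 := by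
  rw [αc, Real.smoothTransition.one_of_one_le (by linarith), mul_one]

/-- `αc_nonneg`: an elementary bound or non-vanishing for the explicit construction (see the module docstring). [folklore] -/
theorem αc_nonneg (x₀ : ℝ) : 0 ≤ αc x₀ := by
  have := Real.smoothTransition.nonneg (2 * x₀ - 1 / 2); unfold αc; positivity

/-- `αc_le`: an elementary bound or non-vanishing for the explicit construction (see the module docstring). [folklore] -/
theorem αc_le (x₀ : ℝ) : αc x₀ ≤ π / 2 := by
  have := Real.smoothTransition.le_one (2 * x₀ - 1 / 2); unfold αc; nlinarith [pi_pos]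

/-- `cos_αc_nonneg`: an elementary bound or non-vanishing for the explicit construction (see the module docstring). [folklore] -/
theorem cos_αc_nonneg (x₀ : ℝ) : 0 ≤ Real.cos (αc x₀) :=
  Real.cos_nonneg_of_mem_Icc ⟨by linarith [αc_nonneg x₀, pi_pos], αc_le x₀⟩

/-- `sin_αc_nonneg`: an elementary bound or non-vanishing for the explicit construction (see the module docstring). [folklore] -/
theorem sin_αc_nonneg (x₀ : ℝ) : 0 ≤ Real.sin (αc x₀) :=
  Real.sin_nonneg_of_nonneg_of_le_pi (αc_nonneg x₀) (by linarith [αc_le x₀, pi_pos])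

/-- `contDiff_αc`: smoothness / differentiability of the explicit profile or map (see the module docstring). [folklore] -/
theorem contDiff_αc : ContDiff ℝ ∞ αc := by
  unfold αc; exact contDiff_const.mul (contDiff_χ_affine 2 (1 / 2))

/-- **The planar arc** from `p` (`x₀ = 0`) to `q` (`x₀ = 1`): polar about `q`, radius `1 - x₀`,
angle `αc x₀`. [folklore] -/
def γ (x₀ : ℝ) : 𝔼 2 := q + (1 - x₀) • vec (Real.cos (αc x₀)) (Real.sin (αc x₀))

/-- `γ_apply_zero`: a value / unfolding of the explicit construction (see the module docstring). [folklore] -/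
theorem γ_apply_zero (x₀ : ℝ) : γ x₀ 0 = qc + (1 - x₀) * Real.cos (αc x₀) := by
  simp [γ]

/-- `γ_apply_one`: a value / unfolding of the explicit construction (see the module docstring). [folklore] -/
theorem γ_apply_one (x₀ : ℝ) : γ x₀ 1 = (1 - x₀) * Real.sin (αc x₀) := by
  simp [γ]

/-- On the straight part `x₀ ≤ 1/4`: `γ x₀ = p - x₀ e₀`. [folklore] -/
theorem γ_of_le {x₀ : ℝ} (h : x₀ ≤ 1 / 4) : γ x₀ = pI + vec (-x₀) 0 := by
  rw [γ, αc_of_le h, Real.cos_zero, Real.sin_zero, pI_eq]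
  simp only [vec, zero_smul, add_zero, one_smul, neg_smul]
  rw [sub_smul, one_smul]; abel

/-- `γ_zero`: an elementary property of the explicit construction (see the module docstring). [folklore] -/
theorem γ_zero : γ 0 = pI := by rw [γ_of_le (by norm_num)]; simp [vec]

/-- `γ_one`: an elementary property of the explicit construction (see the module docstring). [folklore] -/
theorem γ_one : γ 1 = q := by simp [γ]

/-- `contDiff_γ`: smoothness / differentiability of the explicit profile or map (see the module docstring). [folklore] -/
theorem contDiff_γ : ContDiff ℝ ∞ γ := by
  unfold γ
  refine contDiff_const.add ((contDiff_const.sub contDiff_id).smul ?_)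
  unfold vec
  exact ((Real.contDiff_cos.comp contDiff_αc).smul contDiff_const).add
    ((Real.contDiff_sin.comp contDiff_αc).smul contDiff_const)

/-- The offset of the arc from `q` has norm `|1 - x₀|`. [folklore] -/
theorem norm_γ_sub_q (x₀ : ℝ) : ‖γ x₀ - q‖ = |1 - x₀| := by
  rw [γ, add_sub_cancel_left, norm_smul, Real.norm_eq_abs]
  have : vec (Real.cos (αc x₀)) (Real.sin (αc x₀)) =
      vec (1 * Real.cos (αc x₀)) (1 * Real.sin (αc x₀)) := by simp
  rw [this, norm_vec_polar, abs_one, mul_one]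

/-- **The arc is injective.** For `x₀ < 1` the radius `1 - x₀` about `q` is strictly decreasing;
past `1` the arc descends the vertical line below `q`; the two pieces and `q` are disjoint.
[folklore] -/
theorem γ_injective : Injective γ := by
  intro a b h
  have hn : |1 - a| = |1 - b| := by rw [← norm_γ_sub_q, ← norm_γ_sub_q, h]
  -- second coordinates: `(1 - x₀) sin α ≥ 0` iff `x₀ ≤ 1` (for `x₀ > 1`, `sin α = 1`)
  have h1 := congrArg (fun v : 𝔼 2 ↦ v 1) h
  simp only [γ_apply_one] at h1
  rcases abs_eq_abs.1 hn with hab | hab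
  · linarith
  · -- `1 - a = -(1 - b)`, i.e. `a + b = 2`; then one of them is `> 1` unless `a = b = 1`
    rcases lt_trichotomy a 1 with ha | rfl | ha
    · have hb : 1 < b := by linarith
      have hsb : Real.sin (αc b) = 1 := by rw [αc_of_ge (by linarith), Real.sin_pi_div_two]
      rw [hsb, mul_one] at h1
      have : 0 ≤ (1 - a) * Real.sin (αc a) := mul_nonneg (by linarith) (sin_αc_nonneg a)
      linarith
    · linarith
    · have hb : b < 1 := by linarith
      have hsa : Real.sin (αc a) = 1 := by rw [αc_of_ge (by linarith), Real.sin_pi_div_two]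
      rw [hsa, mul_one] at h1
      have : 0 ≤ (1 - b) * Real.sin (αc b) := mul_nonneg (by linarith) (sin_αc_nonneg b)
      linarith

/-- **Away from the attaching end the arc stays `≥ 1/8` from `p`**: for `x₀ ≥ 1/8`,
`‖γ x₀ - p‖ ≥ 1/8`. [folklore] -/
theorem norm_γ_sub_pI_ge {x₀ : ℝ} (h : 1 / 8 ≤ x₀) : 1 / 8 ≤ ‖γ x₀ - pI‖ := by
  have hsq : ‖γ x₀ - pI‖ ^ 2 = (1 - x₀) ^ 2 - 2 * (1 - x₀) * Real.cos (αc x₀) + 1 := by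
    have : γ x₀ - pI = vec ((1 - x₀) * Real.cos (αc x₀) - 1) ((1 - x₀) * Real.sin (αc x₀)) := by
      rw [γ, pI_eq]
      ext i; fin_cases i <;> simp [vec] <;> ring
    rw [this, norm_vec, Real.sq_sqrt (by positivity)]
    nlinarith [Real.sin_sq_add_cos_sq (αc x₀)]
  have hc0 := cos_αc_nonneg x₀
  have hc1 := Real.cos_le_one (αc x₀)
  have hlow : (1 / 8 : ℝ) ^ 2 ≤ ‖γ x₀ - pI‖ ^ 2 := by
    rw [hsq]
    rcases le_or_gt x₀ 1 with hx | hx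
    · nlinarith
    · nlinarith
  exact le_of_pow_le_pow_left₀ two_ne_zero (norm_nonneg _) hlow

/-- **The arc misses the axis segment `[0, 1/√5) e₀`** (the knot and the collar). [folklore] -/
theorem γ_ne_smul {x₀ c : ℝ} (hc : c < qc) : γ x₀ ≠ c • e₀ := by
  intro h
  have h0 := congrArg (fun v : 𝔼 2 ↦ v 0) h
  have h1 := congrArg (fun v : 𝔼 2 ↦ v 1) h
  simp only [γ_apply_zero, γ_apply_one, PiLp.smul_apply, smul_eq_mul, e₀_apply_zero, mul_one,
    e₀_apply_one, mul_zero] at h0 h1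
  -- `(1 - x₀) cos α < 0`
  have hneg : (1 - x₀) * Real.cos (αc x₀) < 0 := by linarith
  rcases mul_eq_zero.1 h1 with hx | hs
  · rw [hx, zero_mul] at hneg; exact lt_irrefl _ hneg
  · -- `sin α = 0` forces `α = 0`, `cos α = 1`, so `x₀ > 1`; but then `α = π/2`
    have hα0 : αc x₀ = 0 := by
      rcases (αc_nonneg x₀).lt_or_eq with hpos | h0'
      · exfalso
        have := Real.sin_pos_of_pos_of_lt_pi hpos (by linarith [αc_le x₀, pi_pos])
        linarith
      · exact h0'.symm
    rw [hα0, Real.cos_zero, mul_one] at hneg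
    have : αc x₀ = π / 2 := αc_of_ge (by linarith)
    rw [hα0] at this
    linarith [pi_pos]

/-- The derivative of the arc never vanishes (its radial component is `-1`). [folklore] -/
theorem hasDerivAt_γ (x₀ : ℝ) : HasDerivAt γ
    (vec (-Real.cos (αc x₀) - (1 - x₀) * Real.sin (αc x₀) * deriv αc x₀)
      (-Real.sin (αc x₀) + (1 - x₀) * Real.cos (αc x₀) * deriv αc x₀)) x₀ := by
  have hα : HasDerivAt αc (deriv αc x₀) x₀ :=
    ((contDiff_αc.differentiable (by simp)) x₀).hasDerivAt
  have h1 : HasDerivAt (fun x : ℝ ↦ 1 - x) (-1) x₀ := by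
    simpa using (hasDerivAt_id x₀).const_sub 1
  have hf : HasDerivAt (fun x ↦ (1 - x) * Real.cos (αc x))
      (-1 * Real.cos (αc x₀) + (1 - x₀) * (-Real.sin (αc x₀) * deriv αc x₀)) x₀ := h1.mul hα.cos
  have hg : HasDerivAt (fun x ↦ (1 - x) * Real.sin (αc x))
      (-1 * Real.sin (αc x₀) + (1 - x₀) * (Real.cos (αc x₀) * deriv αc x₀)) x₀ := h1.mul hα.sin
  have hγ : γ = fun x ↦ q + vec ((1 - x) * Real.cos (αc x)) ((1 - x) * Real.sin (αc x)) := by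
    funext x; simp only [γ, vec, smul_add, smul_smul]
  rw [hγ]
  refine ((hasDerivAt_vec hf hg).const_add q).congr_deriv ?_
  congr 1 <;> ring

/-- `deriv_γ_ne_zero`: a derivative of the explicit profile or map (see the module docstring). [folklore] -/
theorem deriv_γ_ne_zero (x₀ : ℝ) : deriv γ x₀ ≠ 0 := by
  rw [(hasDerivAt_γ x₀).deriv]
  intro h
  rw [vec_eq_zero_iff] at h
  have := Real.sin_sq_add_cos_sq (αc x₀)
  have h3 : Real.cos (αc x₀) * (-Real.cos (αc x₀) - (1 - x₀) * Real.sin (αc x₀) * deriv αc x₀) +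
      Real.sin (αc x₀) * (-Real.sin (αc x₀) + (1 - x₀) * Real.cos (αc x₀) * deriv αc x₀) = 0 := by
    rw [h.1, h.2]; ring
  exact absurd (show (-1 : ℝ) = 0 by linear_combination h3 + this) (by norm_num)

/-! ## The coordinate map `Ψ` and the band -/

/-- The flap variables `(s, y) = (-3/100 - x₀, -x₁)`. [folklore] -/
def flapArg (x : 𝔼 2) : ℝ × ℝ := (-(3 / 100) - x 0, -x 1)

/-- The flap formula: `(axial, p + fibre)` in the flap variables. [folklore] -/
def Ψ₁ (x : 𝔼 2) : ℝ × 𝔼 2 := ((Φ (flapArg x)).1, pI + (Φ (flapArg x)).2)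

/-- The honest formula: `(-x₁, γ x₀)`. [folklore] -/
def Ψ₂ (x : 𝔼 2) : ℝ × 𝔼 2 := (-x 1, γ (x 0))

/-- **The coordinate map**: flap formula for `x₀ < 1/8`, honest formula otherwise. [folklore] -/
def Ψ (x : 𝔼 2) : ℝ × 𝔼 2 := if x 0 < 1 / 8 then Ψ₁ x else Ψ₂ x

/-- **The two formulas agree on the strip `-7/200 < x₀ < 1/4`.** [folklore] -/
theorem Ψ₁_eq_Ψ₂ {x : 𝔼 2} (h₁ : -(7 / 200) < x 0) (h₂ : x 0 < 1 / 4) : Ψ₁ x = Ψ₂ x := by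
  have hs : -(3 / 100) - x 0 ≤ 1 / 200 := by linarith
  rw [Ψ₁, flapArg, Φ_of_le hs, Ψ₂, γ_of_le h₂.le]
  congr 2
  simp only [vec, zero_smul, add_zero]
  rw [show (3 / 100 + (-(3 / 100) - x 0) : ℝ) = -x 0 by ring]

/-- `Ψ_eq_Ψ₁`: an elementary property of the explicit construction (see the module docstring). [folklore] -/
theorem Ψ_eq_Ψ₁ {x : 𝔼 2} (h : x 0 < 1 / 4) : Ψ x = Ψ₁ x := by
  by_cases h' : x 0 < 1 / 8
  · rw [Ψ, if_pos h']
  · rw [Ψ, if_neg h', Ψ₁_eq_Ψ₂ (by linarith) h]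

/-- `Ψ_eq_Ψ₂`: an elementary property of the explicit construction (see the module docstring). [folklore] -/
theorem Ψ_eq_Ψ₂ {x : 𝔼 2} (h : -(7 / 200) < x 0) : Ψ x = Ψ₂ x := by
  by_cases h' : x 0 < 1 / 8
  · rw [Ψ, if_pos h', Ψ₁_eq_Ψ₂ h (by linarith)]
  · rw [Ψ, if_neg h']

/-- **The wild band** `x ↦ μ (circlePoint X, w)`, `(X, w) = Ψ x`. [folklore] -/
def band (x : 𝔼 2) : 𝕊 3 := μ.param (Ψ x)

/-- `band_apply`: a value / unfolding of the explicit construction (see the module docstring). [folklore] -/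
theorem band_apply (x : 𝔼 2) : band μ x = μ (circlePoint (Ψ x).1, (Ψ x).2) := rfl

/-- On the left edge line: `band (0, u) = μ (circlePoint (-u), p)`. [folklore] -/
theorem band_pt2_zero (u : ℝ) : band μ (pt2 0 u) = μ (circlePoint (-u), pI) := by
  have h0 : (pt2 0 u : 𝔼 2) 0 = 0 := rfl
  have h1 : (pt2 0 u : 𝔼 2) 1 = u := rfl
  rw [band_apply, Ψ_eq_Ψ₂ (by rw [h0]; norm_num), Ψ₂, h0, h1, γ_zero]

/-- On the right edge line: `band (1, u) = μ (circlePoint (-u), q)`. [folklore] -/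
theorem band_pt2_one (u : ℝ) : band μ (pt2 1 u) = μ (circlePoint (-u), q) := by
  have h0 : (pt2 1 u : 𝔼 2) 0 = 1 := rfl
  have h1 : (pt2 1 u : 𝔼 2) 1 = u := rfl
  rw [band_apply, Ψ_eq_Ψ₂ (by rw [h0]; norm_num), Ψ₂, h0, h1, γ_one]

/-! ## Smoothness -/

/-- `contDiff_apply_coord`: smoothness / differentiability of the explicit profile or map (see the module docstring). [folklore] -/
theorem contDiff_apply_coord (i : Fin 2) : ContDiff ℝ ∞ fun x : 𝔼 2 ↦ x i :=
  contDiff_piLp_apply (p := 2) (i := i)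

/-- `contDiff_flapArg`: smoothness / differentiability of the explicit profile or map (see the module docstring). [folklore] -/
theorem contDiff_flapArg : ContDiff ℝ ∞ flapArg :=
  (contDiff_const.sub (contDiff_apply_coord 0)).prodMk (contDiff_apply_coord 1).neg

/-- `contDiff_Ψ₁`: smoothness / differentiability of the explicit profile or map (see the module docstring). [folklore] -/
theorem contDiff_Ψ₁ : ContDiff ℝ ∞ Ψ₁ := by
  have h := contDiff_Φ.comp contDiff_flapArg
  exact (contDiff_fst.comp h).prodMk (contDiff_const.add (contDiff_snd.comp h))

/-- `contDiff_Ψ₂`: smoothness / differentiability of the explicit profile or map (see the module docstring). [folklore] -/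
theorem contDiff_Ψ₂ : ContDiff ℝ ∞ Ψ₂ :=
  (contDiff_apply_coord 1).neg.prodMk (contDiff_γ.comp (contDiff_apply_coord 0))

/-- `isOpen_lt_fst`: an elementary bound or non-vanishing for the explicit construction (see the module docstring). [folklore] -/
theorem isOpen_lt_fst (a : ℝ) : IsOpen {x : 𝔼 2 | x 0 < a} :=
  isOpen_lt (EuclideanSpace.proj (0 : Fin 2)).continuous continuous_const

/-- `isOpen_gt_fst`: an elementary bound or non-vanishing for the explicit construction (see the module docstring). [folklore] -/
theorem isOpen_gt_fst (a : ℝ) : IsOpen {x : 𝔼 2 | a < x 0} :=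
  isOpen_lt continuous_const (EuclideanSpace.proj (0 : Fin 2)).continuous

/-- `Ψ_eventuallyEq_Ψ₁`: an elementary property of the explicit construction (see the module docstring). [folklore] -/
theorem Ψ_eventuallyEq_Ψ₁ {x : 𝔼 2} (h : x 0 < 1 / 4) : Ψ =ᶠ[𝓝 x] Ψ₁ := by
  filter_upwards [(isOpen_lt_fst (1 / 4)).mem_nhds h] with z hz
  exact Ψ_eq_Ψ₁ hz

/-- `Ψ_eventuallyEq_Ψ₂`: an elementary property of the explicit construction (see the module docstring). [folklore] -/
theorem Ψ_eventuallyEq_Ψ₂ {x : 𝔼 2} (h : -(7 / 200) < x 0) : Ψ =ᶠ[𝓝 x] Ψ₂ := by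
  filter_upwards [(isOpen_gt_fst (-(7 / 200))).mem_nhds h] with z hz
  exact Ψ_eq_Ψ₂ hz

/-- **The coordinate map is `C^∞`.** [folklore] -/
theorem contDiff_Ψ : ContDiff ℝ ∞ Ψ := by
  rw [contDiff_iff_contDiffAt]
  intro x
  rcases lt_or_ge (x 0) (1 / 8) with h | h
  · exact contDiff_Ψ₁.contDiffAt.congr_of_eventuallyEq (Ψ_eventuallyEq_Ψ₁ (by linarith))
  · exact contDiff_Ψ₂.contDiffAt.congr_of_eventuallyEq (Ψ_eventuallyEq_Ψ₂ (by linarith))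

/-- **The wild band is `C^∞`.** [folklore] -/
theorem contMDiff_band : ContMDiff 𝓘(ℝ, 𝔼 2) (𝓡 3) ∞ (band μ) :=
  μ.contMDiff_param.comp contDiff_Ψ.contMDiff

/-! ## Angles and the injectivity of the angle-coordinate parametrisation -/

/-- Equal points of the circle have angles differing by a multiple of `2π`. [folklore] -/
theorem exists_int_of_circlePoint_eq {a b : ℝ} (h : circlePoint a = circlePoint b) :
    ∃ k : ℤ, b = a + k * (2 * π) := by
  have hc : Real.cos a = Real.cos b := by
    rw [← circlePoint_apply_zero, ← circlePoint_apply_zero, h]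
  have hs : Real.sin a = Real.sin b := by
    rw [← circlePoint_apply_one, ← circlePoint_apply_one, h]
  have hang : (b : Real.Angle) = (a : Real.Angle) := (Real.Angle.cos_sin_inj hc hs).symm
  rw [Real.Angle.angle_eq_iff_two_pi_dvd_sub] at hang
  obtain ⟨k, hk⟩ := hang
  exact ⟨k, by linarith⟩

/-- **`param` is injective on angle windows shorter than `2π`.** [folklore] -/
theorem param_inj {a b : ℝ} {w w' : 𝔼 2} (h : μ.param (a, w) = μ.param (b, w'))
    (hab : |a - b| < 2 * π) : a = b ∧ w = w' := by
  rw [Knot.TubularNbhd.param_apply, Knot.TubularNbhd.param_apply] at h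
  have h' := μ.injective h
  simp only [Prod.mk.injEq] at h'
  obtain ⟨k, hk⟩ := exists_int_of_circlePoint_eq h'.1
  refine ⟨?_, h'.2⟩
  have hk0 : k = 0 := by
    have h1 : |(k : ℝ)| < 1 := by
      have h2 : |(k : ℝ)| * (2 * π) < 1 * (2 * π) := by
        have : |a - b| = |(k : ℝ)| * (2 * π) := by
          rw [show a - b = -(k : ℝ) * (2 * π) by linarith, abs_mul, abs_neg,
            abs_of_pos (by positivity : (0 : ℝ) < 2 * π)]
        linarith
      exact lt_of_mul_lt_mul_right h2 (by positivity)
    have h3 : |k| < 1 := by exact_mod_cast h1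
    have := abs_lt.1 h3
    omega
  rw [hk0] at hk; simp at hk; linarith

/-! ## The square and the values of `Ψ` on it -/

/-- The collar square of width `1/10`, unfolded. [folklore] -/
theorem mem_sq {x : 𝔼 2} (hx : x ∈ squareNhd (1 / 10)) :
    x 0 ∈ Ioo (-(1 / 10) : ℝ) (11 / 10) ∧ x 1 ∈ Ioo (-(1 / 10) : ℝ) (11 / 10) := by
  rw [mem_squareNhd_iff] at hx
  have h0 := hx 0; have h1 := hx 1
  norm_num at h0 h1
  exact ⟨h0, h1⟩

/-- The flap variables of a point of the square with `x₀ < 0` lie in the injectivity domain of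
the flap. [folklore] -/
theorem flapArg_mem {x : 𝔼 2} (hx : x ∈ squareNhd (1 / 10)) (h0 : x 0 < 0) :
    (flapArg x).1 ∈ Ioo (-(3 / 100) : ℝ) (7 / 100) ∧ (flapArg x).2 ∈ Ioo (-(11 / 10) : ℝ) (1 / 10) := by
  obtain ⟨hx0, hx1⟩ := mem_sq hx
  simp only [flapArg]
  exact ⟨⟨by linarith, by linarith [hx0.1]⟩, ⟨by linarith [hx1.2], by linarith [hx1.1]⟩⟩

/-- The second flap variable of a point of the square lies in `(-11/10, 1/10)`. [folklore] -/
theorem flapArg_snd_mem {x : 𝔼 2} (hx : x ∈ squareNhd (1 / 10)) :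
    (flapArg x).2 ∈ Ioo (-(11 / 10) : ℝ) (1 / 10) := by
  obtain ⟨-, hx1⟩ := mem_sq hx
  simp only [flapArg]
  exact ⟨by linarith [hx1.2], by linarith [hx1.1]⟩

/-- **The axial coordinate of the band stays in `(-11/10, 7/10)`** on the square (a window
shorter than `2π`). [folklore] -/
theorem Ψ_fst_mem {x : 𝔼 2} (hx : x ∈ squareNhd (1 / 10)) :
    (Ψ x).1 ∈ Ioo (-(11 / 10) : ℝ) (7 / 10) := by
  obtain ⟨hx0, hx1⟩ := mem_sq hx
  rcases lt_or_ge (x 0) (1 / 8) with h | h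
  · rw [Ψ_eq_Ψ₁ (by linarith), Ψ₁, Φ_fst]
    have hy := flapArg_snd_mem hx
    exact axial_mem hy.1 hy.2
  · rw [Ψ_eq_Ψ₂ (by linarith), Ψ₂]
    exact ⟨by simp only; linarith [hx1.2], by simp only; linarith [hx1.1]⟩

/-- On the flap part `x₀ < 0` of the square: the fibre coordinate is `p + fibre s y` with the
flap's fibre nonzero, of norm `≤ 6/100`, and with positive first coordinate unless the axial
coordinate exceeds `1/10`. [folklore] -/
theorem Ψ_of_neg {x : 𝔼 2} (h0 : x 0 < 0) :
    Ψ x = (axial (flapArg x).1 (flapArg x).2, pI + fibre (flapArg x).1 (flapArg x).2) := by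
  rw [Ψ_eq_Ψ₁ (by linarith), Ψ₁, Φ_fst, Φ_snd]

/-- On the honest part `-7/200 < x₀` of the square: `Ψ x = (-x₁, γ x₀)`. [folklore] -/
theorem Ψ_of_gt {x : 𝔼 2} (h0 : -(7 / 200) < x 0) : Ψ x = (-x 1, γ (x 0)) := by
  rw [Ψ_eq_Ψ₂ h0, Ψ₂]

/-! ## Injectivity on the square -/

/-- A point of the flap part and a point of the honest part of the square have different
coordinates. [folklore] -/
theorem Ψ_ne_of_neg_of_nonneg {x x' : 𝔼 2} (hx : x ∈ squareNhd (1 / 10))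
    (hx' : x' ∈ squareNhd (1 / 10)) (h0 : x 0 < 0) (h0' : 0 ≤ x' 0) : Ψ x ≠ Ψ x' := by
  intro h
  obtain ⟨hs, hy⟩ := flapArg_mem hx h0
  obtain ⟨hx0', hx1'⟩ := mem_sq hx'
  rw [Ψ_of_neg h0, Ψ_of_gt (by linarith)] at h
  have hX : axial (flapArg x).1 (flapArg x).2 = -x' 1 := congrArg Prod.fst h
  have hw : pI + fibre (flapArg x).1 (flapArg x).2 = γ (x' 0) := congrArg Prod.snd h
  rcases lt_or_ge (x' 0) (1 / 8) with h8 | h8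
  · rw [γ_of_le (by linarith)] at hw
    have hf : fibre (flapArg x).1 (flapArg x).2 = vec (-x' 0) 0 := add_left_cancel hw
    rcases fibre_fst_pos_or_axial_gt hs hy with hpos | hgt
    · rw [hf, vec_apply_zero] at hpos; linarith
    · rw [hX] at hgt; linarith [hx1'.1]
  · have h1 := norm_γ_sub_pI_ge h8
    have h2 := norm_fibre_le hs (flapArg x).2
    rw [← hw, add_sub_cancel_left] at h1
    linarith

/-- **The coordinate map is injective on the square.** [folklore] -/
theorem injOn_Ψ : InjOn Ψ (squareNhd (1 / 10)) := by
  intro x hx x' hx' h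
  rcases lt_or_ge (x 0) 0 with h0 | h0 <;> rcases lt_or_ge (x' 0) 0 with h0' | h0'
  · -- both in the flap part
    obtain ⟨hs, hy⟩ := flapArg_mem hx h0
    obtain ⟨hs', hy'⟩ := flapArg_mem hx' h0'
    rw [Ψ_of_neg h0, Ψ_of_neg h0'] at h
    have hX : axial (flapArg x).1 (flapArg x).2 = axial (flapArg x').1 (flapArg x').2 :=
      congrArg Prod.fst h
    have hF : pI + fibre (flapArg x).1 (flapArg x).2 = pI + fibre (flapArg x').1 (flapArg x').2 :=
      congrArg Prod.snd h
    have hΦ : Φ (flapArg x) = Φ (flapArg x') := Prod.ext hX (add_left_cancel hF)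
    have harg := injOn_Φ ⟨hs, hy⟩ ⟨hs', hy'⟩ hΦ
    simp only [flapArg, Prod.mk.injEq] at harg
    ext i; fin_cases i
    · change x 0 = x' 0; linarith [harg.1]
    · change x 1 = x' 1; linarith [harg.2]
  · exact absurd h (Ψ_ne_of_neg_of_nonneg hx hx' h0 h0')
  · exact absurd h.symm (Ψ_ne_of_neg_of_nonneg hx' hx h0' h0)
  · -- both in the honest part
    rw [Ψ_of_gt (by linarith), Ψ_of_gt (by linarith)] at h
    simp only [Prod.mk.injEq, neg_inj] at h
    have h00 := γ_injective h.2
    ext i; fin_cases i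
    · exact h00
    · exact h.1

/-- **The wild band is injective on the square.** [folklore] -/
theorem injOn_band : InjOn (band μ) (squareNhd (1 / 10)) := by
  intro x hx x' hx' h
  have hw := Ψ_fst_mem hx
  have hw' := Ψ_fst_mem hx'
  have key := param_inj μ (a := (Ψ x).1) (b := (Ψ x').1) (w := (Ψ x).2) (w' := (Ψ x').2) h
    (by
      have h3 : (3 : ℝ) < π := Real.pi_gt_three
      rw [abs_lt]; constructor <;> linarith [hw.1, hw.2, hw'.1, hw'.2])
  exact injOn_Ψ hx hx' (Prod.ext key.1 key.2)

/-! ## The immersion property -/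

/-- The linear part of the flap variables. [folklore] -/
def flapArgLin : 𝔼 2 →L[ℝ] ℝ × ℝ :=
  (-(EuclideanSpace.proj (0 : Fin 2) : 𝔼 2 →L[ℝ] ℝ)).prod (-(EuclideanSpace.proj (1 : Fin 2)))

/-- `hasFDerivAt_flapArg`: a derivative of the explicit profile or map (see the module docstring). [folklore] -/
theorem hasFDerivAt_flapArg (x : 𝔼 2) : HasFDerivAt flapArg flapArgLin x := by
  have h0 : HasFDerivAt (fun z : 𝔼 2 ↦ -(3 / 100) - z 0)
      (-(EuclideanSpace.proj (0 : Fin 2) : 𝔼 2 →L[ℝ] ℝ)) x := by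
    have := ((EuclideanSpace.proj (0 : Fin 2) : 𝔼 2 →L[ℝ] ℝ).hasFDerivAt (x := x)).const_sub (-(3 / 100))
    simpa using this
  have h1 : HasFDerivAt (fun z : 𝔼 2 ↦ -z 1) (-(EuclideanSpace.proj (1 : Fin 2) : 𝔼 2 →L[ℝ] ℝ)) x :=
    ((EuclideanSpace.proj (1 : Fin 2) : 𝔼 2 →L[ℝ] ℝ).hasFDerivAt (x := x)).neg
  exact h0.prodMk h1

/-- `flapArgLin_injective`: an elementary property of the explicit construction (see the module docstring). [folklore] -/
theorem flapArgLin_injective : Injective flapArgLin := by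
  intro v v' h
  simp only [flapArgLin, ContinuousLinearMap.prod_apply, Prod.mk.injEq] at h
  obtain ⟨h0, h1⟩ := h
  change -(v 0) = -(v' 0) at h0
  change -(v 1) = -(v' 1) at h1
  ext i; fin_cases i
  · change v 0 = v' 0; linarith
  · change v 1 = v' 1; linarith

/-- The outer affine map `(X, w) ↦ (X, p + w)` of the flap formula. [folklore] -/
theorem hasFDerivAt_shift (z : ℝ × 𝔼 2) :
    HasFDerivAt (fun z : ℝ × 𝔼 2 ↦ (z.1, pI + z.2))
      ((ContinuousLinearMap.fst ℝ ℝ (𝔼 2)).prod (ContinuousLinearMap.snd ℝ ℝ (𝔼 2))) z :=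
  hasFDerivAt_fst.prodMk ((hasFDerivAt_const pI z).add hasFDerivAt_snd |>.congr_fderiv (by simp))

/-- **The derivative of the coordinate map is injective** at every point of the square.
[folklore] -/
theorem injective_fderiv_Ψ {x : 𝔼 2} (hx : x ∈ squareNhd (1 / 10)) :
    Injective (fderiv ℝ Ψ x) := by
  obtain ⟨hx0, hx1⟩ := mem_sq hx
  rcases lt_or_ge (x 0) (1 / 8) with h | h
  · -- flap formula
    rw [(Ψ_eventuallyEq_Ψ₁ (by linarith)).fderiv_eq]
    have hΦ := (differentiable_Φ (flapArg x)).hasFDerivAt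
    have hcomp := (hasFDerivAt_shift (Φ (flapArg x))).comp x (hΦ.comp x (hasFDerivAt_flapArg x))
    have heq : Ψ₁ = (fun z : ℝ × 𝔼 2 ↦ (z.1, pI + z.2)) ∘ Φ ∘ flapArg := rfl
    rw [heq, hcomp.fderiv]
    intro v v' hv
    simp only [ContinuousLinearMap.comp_apply, ContinuousLinearMap.prod_apply, Prod.mk.injEq,
      ContinuousLinearMap.coe_fst', ContinuousLinearMap.coe_snd'] at hv
    have h1 : fderiv ℝ Φ (flapArg x) (flapArgLin v) = fderiv ℝ Φ (flapArg x) (flapArgLin v') :=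
      Prod.ext hv.1 hv.2
    have hs7 : (flapArg x).1 < 7 / 100 := by simp only [flapArg]; linarith [hx0.1]
    exact flapArgLin_injective (injective_fderiv_Φ hs7 _ h1)
  · -- honest formula
    rw [(Ψ_eventuallyEq_Ψ₂ (by linarith)).fderiv_eq]
    set γ' : 𝔼 2 := deriv γ (x 0) with hγ'
    have hγd : Differentiable ℝ γ := contDiff_γ.differentiable (by simp)
    have hγ : HasFDerivAt (fun z : 𝔼 2 ↦ γ (z 0))
        ((EuclideanSpace.proj (0 : Fin 2) : 𝔼 2 →L[ℝ] ℝ).smulRight γ') x := by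
      have hc := (hγd (x 0)).hasDerivAt.hasFDerivAt.comp x
        ((EuclideanSpace.proj (0 : Fin 2) : 𝔼 2 →L[ℝ] ℝ).hasFDerivAt (x := x))
      refine hc.congr_fderiv ?_
      ext v i
      simp [hγ']
    have h1 : HasFDerivAt (fun z : 𝔼 2 ↦ -z 1) (-(EuclideanSpace.proj (1 : Fin 2) : 𝔼 2 →L[ℝ] ℝ)) x :=
      ((EuclideanSpace.proj (1 : Fin 2) : 𝔼 2 →L[ℝ] ℝ).hasFDerivAt (x := x)).neg
    have hΨ₂ : HasFDerivAt Ψ₂ _ x := h1.prodMk hγ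
    rw [hΨ₂.fderiv]
    intro v v' hv
    simp only [ContinuousLinearMap.prod_apply, Prod.mk.injEq, ContinuousLinearMap.smulRight_apply]
      at hv
    obtain ⟨hv1, hv0⟩ := hv
    change -(v 1) = -(v' 1) at hv1
    change (v 0) • γ' = (v' 0) • γ' at hv0
    have hd : γ' ≠ 0 := deriv_γ_ne_zero (x 0)
    have hv0' : v 0 = v' 0 := by
      have : (v 0 - v' 0) • γ' = 0 := by rw [sub_smul, hv0, sub_self]
      rcases smul_eq_zero.1 this with h0 | h0
      · linarith
      · exact absurd h0 hd
    ext i; fin_cases i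
    · exact hv0'
    · change v 1 = v' 1; linarith

/-- **The wild band is an immersion on the square.** [folklore] -/
theorem injective_mfderiv_band {x : 𝔼 2} (hx : x ∈ squareNhd (1 / 10)) :
    Injective (mfderiv 𝓘(ℝ, 𝔼 2) (𝓡 3) (band μ) x) := by
  have hn : (∞ : WithTop ℕ∞) ≠ 0 := by simp
  have hΨ : ContMDiff 𝓘(ℝ, 𝔼 2) 𝓘(ℝ, ℝ × 𝔼 2) ∞ Ψ := contDiff_Ψ.contMDiff
  have h := mfderiv_comp x (μ.contMDiff_param.mdifferentiableAt hn) (hΨ.mdifferentiableAt hn)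
  change mfderiv 𝓘(ℝ, 𝔼 2) (𝓡 3) (μ.param ∘ Ψ) x = _ at h
  rw [show band μ = μ.param ∘ Ψ from rfl, h]
  have h2 : Injective (mfderiv 𝓘(ℝ, 𝔼 2) 𝓘(ℝ, ℝ × 𝔼 2) Ψ x) := by
    rw [mfderiv_eq_fderiv]; exact injective_fderiv_Ψ hx
  exact (μ.mfderiv_param_injective (Ψ x)).comp h2

/-! ## The fibre coordinate on the square: off the knot, the collar, and the two strands -/

/-- On the flap part, the fibre coordinate of the band has first coordinate `> 1/√5` (so it is
off the knot and off the collar) and is neither `p` nor `q`. [folklore] -/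
theorem Ψ_snd_facts_of_neg {x : 𝔼 2} (hx : x ∈ squareNhd (1 / 10)) (h0 : x 0 < 0) :
    qc < (Ψ x).2 0 ∧ (Ψ x).2 ≠ pI ∧ (Ψ x).2 ≠ q := by
  obtain ⟨hs, hy⟩ := flapArg_mem hx h0
  rw [Ψ_of_neg h0]
  set f := fibre (flapArg x).1 (flapArg x).2 with hf
  have hfn : ‖f‖ ≤ 6 / 100 := norm_fibre_le hs _
  have hf0 : |f 0| ≤ 6 / 100 := (abs_apply_le_norm f 0).trans hfn
  have hfne : f ≠ 0 := fibre_ne_zero' hs _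
  refine ⟨?_, ?_, ?_⟩
  · simp only [PiLp.add_apply, pI_apply_zero]
    have := qc_pos
    rw [abs_le] at hf0
    linarith [hf0.1]
  · intro h; exact hfne (by simpa using h)
  · intro h
    have h0' := congrArg (fun v : 𝔼 2 ↦ v 0) h
    simp only [PiLp.add_apply, pI_apply_zero, q_apply_zero] at h0'
    rw [abs_le] at hf0
    linarith [hf0.1]

/-- On the honest part `0 ≤ x₀ < 1/8`... more generally on `-7/200 < x₀`, the fibre coordinate is
`γ x₀`: off the axis segment, `= p` iff `x₀ = 0`, `= q` iff `x₀ = 1`. [folklore] -/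
theorem Ψ_snd_eq_pI_iff {x : 𝔼 2} (h0 : -(7 / 200) < x 0) : (Ψ x).2 = pI ↔ x 0 = 0 := by
  rw [Ψ_of_gt h0, ← γ_zero, γ_injective.eq_iff]

/-- `Ψ_snd_eq_q_iff`: an elementary property of the explicit construction (see the module docstring). [folklore] -/
theorem Ψ_snd_eq_q_iff {x : 𝔼 2} (h0 : -(7 / 200) < x 0) : (Ψ x).2 = q ↔ x 0 = 1 := by
  rw [Ψ_of_gt h0, ← γ_one, γ_injective.eq_iff]

/-- **The band meets the attaching strand `p` exactly over `x₀ = 0`.** [folklore] -/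
theorem Ψ_snd_eq_pI_iff' {x : 𝔼 2} (hx : x ∈ squareNhd (1 / 10)) : (Ψ x).2 = pI ↔ x 0 = 0 := by
  rcases lt_or_ge (x 0) 0 with h0 | h0
  · exact ⟨fun h ↦ absurd h (Ψ_snd_facts_of_neg hx h0).2.1, fun h ↦ absurd h h0.ne⟩
  · exact Ψ_snd_eq_pI_iff (by linarith)

/-- **The band meets the push-off strand `q` exactly over `x₀ = 1`.** [folklore] -/
theorem Ψ_snd_eq_q_iff' {x : 𝔼 2} (hx : x ∈ squareNhd (1 / 10)) : (Ψ x).2 = q ↔ x 0 = 1 := by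
  rcases lt_or_ge (x 0) 0 with h0 | h0
  · exact ⟨fun h ↦ absurd h (Ψ_snd_facts_of_neg hx h0).2.2, fun h ↦ by linarith⟩
  · exact Ψ_snd_eq_q_iff (by linarith)

/-- **The band misses the axis segment `[0, 1/√5) e₀`** (the knot `K` and the collar of the slide
tube). [folklore] -/
theorem Ψ_snd_ne_smul {x : 𝔼 2} (hx : x ∈ squareNhd (1 / 10)) {c : ℝ} (hc : c < qc) :
    (Ψ x).2 ≠ c • e₀ := by
  rcases lt_or_ge (x 0) 0 with h0 | h0
  · intro h
    have h1 := (Ψ_snd_facts_of_neg hx h0).1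
    rw [h] at h1
    simp at h1
    linarith
  · rw [Ψ_of_gt (by linarith)]
    exact γ_ne_smul hc

/-! ## The pre-band data -/

/-- The band on a point, through `Ψ`. [folklore] -/
theorem band_eq (x : 𝔼 2) : band μ x = μ (circlePoint (Ψ x).1, (Ψ x).2) := rfl

/-- **`KI μ` meets the band exactly in the left edge line.** [folklore] -/
theorem preimage_left :
    band μ ⁻¹' range ⇑(KI μ) ∩ squareNhd (1 / 10) = {x ∈ squareNhd (1 / 10) | x 0 = 0} := by
  ext x
  simp only [mem_inter_iff, mem_preimage, mem_setOf_eq, range_KI, band_eq,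
    apply_mem_image_singleton_iff]
  constructor
  · rintro ⟨h, hx⟩; exact ⟨hx, (Ψ_snd_eq_pI_iff' hx).1 h⟩
  · rintro ⟨hx, h⟩; exact ⟨(Ψ_snd_eq_pI_iff' hx).2 h, hx⟩

/-- **`P μ` meets the band exactly in the right edge line.** [folklore] -/
theorem preimage_right :
    band μ ⁻¹' range ⇑(P μ) ∩ squareNhd (1 / 10) = {x ∈ squareNhd (1 / 10) | x 0 = 1} := by
  ext x
  simp only [mem_inter_iff, mem_preimage, mem_setOf_eq, range_P, band_eq,
    apply_mem_image_singleton_iff]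
  constructor
  · rintro ⟨h, hx⟩; exact ⟨hx, (Ψ_snd_eq_q_iff' hx).1 h⟩
  · rintro ⟨hx, h⟩; exact ⟨(Ψ_snd_eq_q_iff' hx).2 h, hx⟩

/-- **The band misses the knot and the collar of the slide tube.** [folklore] -/
theorem disjoint_avoid :
    Disjoint (band μ '' squareNhd (1 / 10)) (range ⇑K ∪ (slideTube μ).collar) := by
  rw [Set.disjoint_left]
  rintro _ ⟨x, hx, rfl⟩ hz
  rcases hz with hz | hz
  · -- the knot is the zero section
    obtain ⟨u, hu⟩ := hz
    rw [← μ.coe_apply_zero, band_eq] at hu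
    have := congrArg Prod.snd (μ.injective hu)
    exact Ψ_snd_ne_smul hx qc_pos (by rw [← this, zero_smul])
  · obtain ⟨u, c, hc0, hc1, hz⟩ := mem_collar_slideTube μ hz
    rw [band_eq] at hz
    have := congrArg Prod.snd (μ.injective hz)
    exact Ψ_snd_ne_smul hx hc1 this

/-! ### Orientations -/

/-- The `ℝ⁴`-valued band is `C^∞`. [folklore] -/
theorem contDiff_coe_band : ContDiff ℝ ∞ fun x ↦ ((band μ x : 𝕊 3) : 𝔼 4) := by
  rw [← contMDiff_iff_contDiff]
  exact contMDiff_coe_sphere.comp (contMDiff_band μ)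

/-- A directional derivative of a differentiable map is the derivative along the line.
[folklore] -/
theorem fderiv_apply_eq_deriv_line {f : 𝔼 2 → 𝔼 4} {x v : 𝔼 2} (hf : DifferentiableAt ℝ f x) :
    fderiv ℝ f x v = deriv (fun t : ℝ ↦ f (x + t • v)) 0 := by
  have hl : HasDerivAt (fun t : ℝ ↦ x + t • v) v 0 := by
    simpa using ((hasDerivAt_id (0 : ℝ)).smul_const v).const_add x
  have h : HasFDerivAt f (fderiv ℝ f x) (x + (0 : ℝ) • v) := by
    rw [zero_smul, add_zero]; exact hf.hasFDerivAt
  exact ((h.comp_hasDerivAt (0 : ℝ) hl).deriv).symm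

/-- `pt2_zero_add_smul`: an elementary property of the explicit construction (see the module docstring). [folklore] -/
theorem pt2_zero_add_smul (u t : ℝ) : pt2 0 u + t • pt2 0 1 = pt2 0 (u + t) := by
  ext i; fin_cases i
  · simp [pt2]
  · simp [pt2]

/-- `pt2_one_add_smul`: an elementary property of the explicit construction (see the module docstring). [folklore] -/
theorem pt2_one_add_smul (u t : ℝ) : pt2 1 u + t • pt2 0 (-1) = pt2 1 (u - t) := by
  ext i; fin_cases i
  · simp [pt2]
  · simp [pt2]; ring

/-- `paramCoe` is the `ℝ⁴`-valued `μ` in angle form. [folklore] -/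
theorem paramCoe_apply (θ : ℝ) (w : 𝔼 2) : μ.paramCoe (θ, w) = ((μ (circlePoint θ, w) : 𝕊 3) : 𝔼 4) :=
  rfl

/-- `differentiable_paramCoe`: smoothness / differentiability of the explicit profile or map (see the module docstring). [folklore] -/
theorem differentiable_paramCoe : Differentiable ℝ μ.paramCoe :=
  μ.contDiff_paramCoe.differentiable (by simp)

/-- **Orientation of `KI μ` along the left edge: upwards** (`θ = 1/2`, `c = 1`). [folklore] -/
theorem orient_left : ∃ θ c : ℝ, 0 < c ∧ KI μ (circlePoint θ) = band μ (pt2 0 2⁻¹) ∧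
    deriv (fun t ↦ ((KI μ (circlePoint t) : 𝕊 3) : 𝔼 4)) θ =
      c • fderiv ℝ (fun x ↦ ((band μ x : 𝕊 3) : 𝔼 4)) (pt2 0 2⁻¹) (pt2 0 1) := by
  refine ⟨1 / 2, 1, one_pos, ?_, ?_⟩
  · rw [KI_apply_circlePoint, band_pt2_zero]; norm_num
  · rw [one_smul, fderiv_apply_eq_deriv_line ((contDiff_coe_band μ).differentiable (by simp) _)]
    -- both sides are derivatives of `t ↦ paramCoe (-(…), p)`
    have hL : (fun t ↦ ((KI μ (circlePoint t) : 𝕊 3) : 𝔼 4)) = fun t ↦ μ.paramCoe (-t, pI) := by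
      funext t; rw [KI_apply_circlePoint, paramCoe_apply]
    have hR : (fun t : ℝ ↦ ((band μ (pt2 0 2⁻¹ + t • pt2 0 1) : 𝕊 3) : 𝔼 4)) =
        fun t ↦ μ.paramCoe (-(2⁻¹ + t), pI) := by
      funext t; rw [pt2_zero_add_smul, band_pt2_zero, paramCoe_apply]
    rw [hL, hR]
    set f : ℝ → 𝔼 4 := fun u ↦ μ.paramCoe (u, pI) with hf
    have hfd : ∀ u, HasDerivAt f (deriv f u) u := fun u ↦
      ((differentiable_paramCoe μ).comp (differentiable_id.prodMk (differentiable_const _)) u).hasDerivAt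
    have h1 : HasDerivAt (fun t : ℝ ↦ f (-t)) ((-1 : ℝ) • deriv f (-(1 / 2))) (1 / 2) := by
      have hi : HasDerivAt (fun t : ℝ ↦ -t) (-1) (1 / 2) := (hasDerivAt_id (1 / 2 : ℝ)).neg
      exact (hfd (-(1 / 2))).scomp (1 / 2) hi
    have h2 : HasDerivAt (fun t : ℝ ↦ f (-(2⁻¹ + t))) ((-1 : ℝ) • deriv f (-(1 / 2))) 0 := by
      have hi : HasDerivAt (fun t : ℝ ↦ -(2⁻¹ + t)) (-1) 0 :=
        ((hasDerivAt_id (0 : ℝ)).const_add (2⁻¹ : ℝ)).neg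
      refine ((hfd (-(2⁻¹ + 0))).scomp 0 hi).congr_deriv ?_
      norm_num
    change deriv (fun t ↦ f (-t)) (1 / 2) = deriv (fun t ↦ f (-(2⁻¹ + t))) 0
    rw [h1.deriv, h2.deriv]

/-- **Orientation of `P μ` along the right edge: downwards** (`θ = -1/2`, `c = 1`). [folklore] -/
theorem orient_right : ∃ θ c : ℝ, 0 < c ∧ P μ (circlePoint θ) = band μ (pt2 1 2⁻¹) ∧
    deriv (fun t ↦ ((P μ (circlePoint t) : 𝕊 3) : 𝔼 4)) θ =
      c • fderiv ℝ (fun x ↦ ((band μ x : 𝕊 3) : 𝔼 4)) (pt2 1 2⁻¹) (pt2 0 (-1)) := by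
  refine ⟨-(1 / 2), 1, one_pos, ?_, ?_⟩
  · rw [P_apply, band_pt2_one]; norm_num
  · rw [one_smul, fderiv_apply_eq_deriv_line ((contDiff_coe_band μ).differentiable (by simp) _)]
    have hL : (fun t ↦ ((P μ (circlePoint t) : 𝕊 3) : 𝔼 4)) = fun t ↦ μ.paramCoe (t, q) := by
      funext t; rw [P_apply, paramCoe_apply]
    have hR : (fun t : ℝ ↦ ((band μ (pt2 1 2⁻¹ + t • pt2 0 (-1)) : 𝕊 3) : 𝔼 4)) =
        fun t ↦ μ.paramCoe (-(2⁻¹ - t), q) := by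
      funext t; rw [pt2_one_add_smul, band_pt2_one, paramCoe_apply]
    rw [hL, hR]
    set g : ℝ → 𝔼 4 := fun u ↦ μ.paramCoe (u, q) with hg
    have hgd : ∀ u, HasDerivAt g (deriv g u) u := fun u ↦
      ((differentiable_paramCoe μ).comp (differentiable_id.prodMk (differentiable_const _)) u).hasDerivAt
    have h2 : HasDerivAt (fun t : ℝ ↦ g (-(2⁻¹ - t))) ((1 : ℝ) • deriv g (-(1 / 2))) 0 := by
      have hi : HasDerivAt (fun t : ℝ ↦ -(2⁻¹ - t)) 1 0 :=
        (((hasDerivAt_id (0 : ℝ)).const_sub (2⁻¹ : ℝ)).neg).congr_deriv (by norm_num)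
      refine ((hgd (-(2⁻¹ - 0))).scomp 0 hi).congr_deriv ?_
      norm_num
    change deriv g (-(1 / 2)) = deriv (fun t ↦ g (-(2⁻¹ - t))) 0
    rw [h2.deriv, one_smul]

/-- **The wild band is pre-band data** from the attaching knot `KI μ` to the push-off strand
`P μ`, avoiding the knot `K` and the collar of the slide tube, on the collar square of width
`1/10`. [folklore] -/
def preBandData : PreBandData (KI μ) (P μ) (range ⇑K ∪ (slideTube μ).collar) where
  band := band μ
  δ := 1 / 10
  δ_pos := by norm_num
  contMDiff := contMDiff_band μ
  injOn := injOn_band μ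
  injective_mfderiv _ hx := injective_mfderiv_band μ hx
  disjoint_avoid := disjoint_avoid μ
  preimage_left := preimage_left μ
  preimage_right := preimage_right μ
  orient_left := orient_left μ
  orient_right := orient_right μ

/-- The band of the pre-band data. [folklore] -/
@[simp] theorem preBandData_band : (preBandData μ).band = band μ := rfl

/-- The collar width of the pre-band data. [folklore] -/
@[simp] theorem preBandData_δ : (preBandData μ).δ = 1 / 10 := rfl

/-! ## The punctured meridian disc inside the support -/

/-- **The support of the wild band contains the punctured meridian disc**
`{μ (circlePoint (3/5), p + w) | 0 < ‖w‖ < 1/50}` of the attaching knot: these points are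
values of the band on the far collar flap `x₀ ∈ (-1/10, -8/100)` of the open square.
[folklore] -/
theorem mem_support {w : 𝔼 2} (h0 : w ≠ 0) (hw : ‖w‖ < 1 / 50) :
    μ (circlePoint (3 / 5), pI + w) ∈ band μ '' squareNhd (1 / 10) := by
  obtain ⟨s, hs, y, hy, hΦ⟩ := exists_Φ_eq h0 hw
  -- the point of the square with flap variables `(s, y)`
  refine ⟨pt2 (-(3 / 100) - s) (-y), ?_, ?_⟩
  · rw [mem_squareNhd_iff]
    intro i; fin_cases i
    · change -(3 / 100) - s ∈ Ioo (-(1 / 10) : ℝ) (1 + 1 / 10)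
      exact ⟨by linarith [hs.2], by linarith [hs.1]⟩
    · change -y ∈ Ioo (-(1 / 10) : ℝ) (1 + 1 / 10)
      exact ⟨by linarith [hy.2], by linarith [hy.1, ystar_gt]⟩
  · have h0' : (pt2 (-(3 / 100) - s) (-y) : 𝔼 2) 0 = -(3 / 100) - s := rfl
    have h1' : (pt2 (-(3 / 100) - s) (-y) : 𝔼 2) 1 = -y := rfl
    have harg : flapArg (pt2 (-(3 / 100) - s) (-y)) = (s, y) := by
      change (-(3 / 100) - (-(3 / 100) - s), -(-y)) = (s, y)
      norm_num
    rw [band_eq, Ψ_eq_Ψ₁ (by rw [h0']; linarith [hs.1]), Ψ₁, harg, hΦ]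

end WildStrand

end Literature.Topology.FourManifolds
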